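import Summits.HodgeConjecture.CorCM.B01.Transposition.Item6OmegaChiSplitting
import Literature.NumberTheory.GelbartRogawski1991.LocalLineIsometryWeilIntertwiner
import Literature.NumberTheory.Automorphic.Liu2021.LemD1Item3AtVOfSeparation
import Literature.NumberTheory.Automorphic.Liu2021.Def411IrreducibleOfLemD1AsPrinted
import Mathlib.RepresentationTheory.Intertwining
import HarnessLib

/-!
# FLOOR-0 P2, crux H413, sub-line `F0_P2CELocalToGlobal` — STUB (LT) «Liu's local theta type depends only on the LOCAL CLASS of the
# line», AT THE ENUMERATION `Equiv.prodUnique (Fin 3) (Fin 1)`: the line isometry `M_x` descends to an isomorphism `X_v(μ,a₁,χ) ≃ X_v(μ,a₂,χ)`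

Cell hodgecm-mathlib, FLOOR 0, crux item H413 = stmt-HodgeConjecture-24833; sub-line `Cruxes/H413/Lines/F0_P2CELocalToGlobal.lean`
(F0P2-plan (g4) 02:42:11Z, HOME mirror `F0/P2/F0_P2CELocalToGlobal.v1.F0P2-plan-g4.lean` 4e2632f0829cdd1f), stub `stub_LT_localTypeTransport :
StubLTLocalTypeTransport` (:240); seat F0P2-p02 (g2).  PROOF lane (theorems only — no definition, no instance, no notation, no named fact, no
`sorry`), `--supports stmt-HodgeConjecture-24833 --as helper`; no `Lines` module is imported.

WHAT IS PROVED.  `stubLT_prodUnique_holds` has as TYPE the body of `StubLTLocalTypeTransport` with the binder `{n'} (e₁ : Fin 3 × Fin 1 ≃ Fin n')`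
INSTANTIATED at `Equiv.prodUnique (Fin 3) (Fin 1)` and NOTHING ELSE CHANGED (token for token): for a CM field `L`, a real non-degenerate
diagonal frame `dV`, a conjugate-symplectic `μ`, two lines `a₁ a₂ ∈ (L⁺)ˣ`, a character `χ ∈ Chi`, a finite place `v` of `L⁺` and a unit `x` of
`L ⊗ L⁺_v` witnessing `a₂⁻¹δ = x x̄ a₁⁻¹δ` (stub LW), the local theta types `X_v(μ, aᵢ, χ)` — the `χ_W`-twisted coinvariants of the local Weil
representation of the `θ_μ`-attached CM family `OmegaChiSplitting.chiLocalSplittingsD ⟨L⟩ … aᵢ` at `v`, restricted along `k ↦ k ⊗ 1` — are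
isomorphic representations of `U(diag dV)(L⁺_v)` (Mathlib `Representation.Equiv`).  [Liu2021, Lem. D.1 (3)]: «another representative gives an
isomorphic representation», place by place, as an explicit intertwiner.

WHY ONLY `Equiv.prodUnique`.  Every local line-transport brick of the tree is typed at the enumeration `Equiv.prodUnique (Fin N) (Fin 1)` (so that
`𝒮(F_vⁿ) = 𝒮(F_vᴺ)`): `lineTransportOp` on `SchwartzBruhat (Fin N → F_v)`, `lineTransportSection`, `omega_lineTransportSection_finLocalSplittings`, the
line rigidity S6a `lineTransportSplitting_lineTransportSection_congrW_undoubledSplittings_holds` and ★ `lineTransportOp_omegaLoc_localLineInl'`; the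
tree's re-enumeration results (★ `Def411WeilCarriersAtLineReindex`) are ADELIC.  The crux's one consumer pins `HodgeCM.Model.ArchSideTerm.e₁ :=
Equiv.prodUnique (Fin 3) (Fin 1)`; the general-`e₁` statement is left to a local re-enumeration stub (desk's call).

HOW.  §1 (generic, any field `k = ℂ`): a linear equivalence `T : S ≃ S` intertwining `ω₁ ∘ ι₁` with `ω₂ ∘ ι₂` (`ωᵢ` representations of two «big»
groups `Gᵢ` on ONE space, `ιᵢ : U →* Gᵢ`), centres `κ₁ : H₁ →* G₁`, `κ₂′ : H₁ →* G₂` FACTORING through `ιᵢ` by one map `ζ : H₁ → U`, and an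
equality of relation submodules `ker (ω₂ ∘ κ₂′) χ₁ = ker (ω₂ ∘ κ₂) χ₂` (a second presentation `κ₂ : H₂ →* G₂`, `χ₂` of the same centre) give
`(rep χ₁ ω₁) ∘ ι₁ ≃ (rep χ₂ ω₂) ∘ ι₂` on the twisted coinvariants: ★ `TwistedCoinv.mapEquiv` (twist `e := 1`) followed by `Submodule.quotEquivOfEq`,
equivariance checked on representatives (`rep_mk`, `mapEquiv_mk`, `quotEquivOfEq_mk`, `ext_mk`).  §2 the CM instance: `T := M_x`
(`MoeglinVignerasWaldspurger1987.lineTransportOp`), the `k ↦ k ⊗ 1` intertwining is ★ `lineTransportOp_omegaLoc_localLineInl'` (its family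
`congrW L prodUnique … (undoubledSplittings … θ (borelPlaceMeasure L) (cmFinLocalFamily … θ hθ …))` IS `chiLocalSplittingsD ⟨L⟩ prodUnique … θ hθ a`
by `unfold`), the centres factor through `k ↦ k ⊗ 1` (★ `localLineInl_localCenter`: `(z·1₃) ⊗ 1 = z·1₃`), and the relation submodule does not
depend on the line `J_W(aᵢ)` presenting the centre `L_v¹` (★ `LemD1OfPlace.ker_localCenter_eq_of_line`, hermitian-ness ∕ non-degeneracy of
`reindex (diag dV ⊗ J_W a₂)` by ★ `reindex_kronecker_JW_hermitian` ∕ `det_reindex_kronecker_JW_ne_zero`).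

HC_CM is proved only modulo the printed citations until rung 0 closes; this file uses no printed citation as a hypothesis.

## References
* [Liu2021] Y. Liu, Camb. J. Math. 9 (2021) = arXiv:2102.11518, App. D §D.1 Step 3 (l. 5219–5221), Lemma D.1 (3) (l. 5233).
* [MoeglinVignerasWaldspurger1987] C. Mœglin, M.-F. Vignéras, J.-L. Waldspurger, LNM 1291 (1987), Chap. 2 II.1 (A)–(B), Chap. 3 I.1–I.3, IV.4.
* [Kudla1994] S. Kudla, Israel J. Math. 87 (1994), §3 Thm. 3.1.  [GelbartRogawski1991] Invent. Math. 105 (1991), §3.1 Remark p. 457 L4–13.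
-/

set_option autoImplicit false

-- the mandated namespace has the single-problem summit's repeated segment (`HodgeConjecture.HodgeConjecture`)
set_option linter.dupNamespace false

noncomputable section

open scoped Matrix Kronecker ComplexOrder
open NumberField MeasureTheory IsDedekindDomain

namespace Summit.HodgeConjecture.HodgeConjecture.Cruxes.H413.F0P2eStubLTLocalTypeTransport

open Literature.NumberTheory Literature.NumberTheory.Automorphic Literature.NumberTheory.Automorphic.UnitaryGroup
open Literature.NumberTheory.Automorphic.IdeleClassGroup
open Literature.NumberTheory.Automorphic.Liu2021 Literature.NumberTheory.Automorphic.Liu2021.Def411WeilCarriers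
open Literature.NumberTheory.Automorphic.Liu2021.Def411WeilCarriersDoubling
open Literature.NumberTheory.GelbartRogawski1991 Literature.NumberTheory.GelbartRogawski1991.UnitaryDualPair
open Literature.NumberTheory.GelbartRogawski1991.UnitaryDualPair.WeilCoinv
open Literature.NumberTheory.GelbartRogawski1991.UnitaryDualPair.LocalSplitting
open Literature.RepresentationTheory Literature.RepresentationTheory.Liu2021
open Summit.HodgeConjecture.CorCM.Transposition

/-! ## §1 Generic descent: an intertwiner of two models through which the centres factor gives an isomorphism of twisted coinvariants -/

/-- **Descent of an intertwiner to the twisted coinvariants, across two presentations of the centre.**  `ω₁`, `ω₂` representations of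
`G₁`, `G₂` on one space `S`; `ιᵢ : U →* Gᵢ`; a linear equivalence `T` with `T (ω₁ (ι₁ u) v) = ω₂ (ι₂ u) (T v)`; centres `κ₁ : H₁ →* G₁`,
`κ₂′ : H₁ →* G₂` factoring through the `ιᵢ` by one map `ζ`; a second presentation `κ₂ : H₂ →* G₂`, `χ₂` with the SAME relation submodule.
Then `(rep χ₁ ω₁) ∘ ι₁ ≃ (rep χ₂ ω₂) ∘ ι₂`. [cite: GelbartRogawski1991, §3.1 Remark p. 457 L4–13] [cite: Liu2021, App. D §D.1 Step 3 (l. 5221)] -/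
theorem nonempty_equiv_rep_comp_of_intertwiner {G₁ G₂ U H₁ H₂ S : Type*} [Group G₁] [Group G₂] [Group U] [Group H₁] [Group H₂]
    [AddCommGroup S] [Module ℂ S] {ω₁ : Representation ℂ G₁ S} {ω₂ : Representation ℂ G₂ S} {ι₁ : U →* G₁} {ι₂ : U →* G₂}
    {κ₁ : H₁ →* G₁} {κ₂' : H₁ →* G₂} {κ₂ : H₂ →* G₂} {χ₁ : H₁ →* ℂˣ} {χ₂ : H₂ →* ℂˣ}
    {hc₁ : ∀ (g : G₁) (h : H₁), Commute (ω₁ g) ((show Representation ℂ H₁ S from ω₁.comp κ₁) h)}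
    {hc₂ : ∀ (g : G₂) (h : H₂), Commute (ω₂ g) ((show Representation ℂ H₂ S from ω₂.comp κ₂) h)}
    (ζ : H₁ → U) (hκ₁ : ∀ h, κ₁ h = ι₁ (ζ h)) (hκ₂' : ∀ h, κ₂' h = ι₂ (ζ h))
    (T : S ≃ₗ[ℂ] S) (hTι : ∀ (u : U) (v : S), T (ω₁ (ι₁ u) v) = ω₂ (ι₂ u) (T v))
    (hker : TwistedCoinv.ker (show Representation ℂ H₁ S from ω₂.comp κ₂') χ₁ =
      TwistedCoinv.ker (show Representation ℂ H₂ S from ω₂.comp κ₂) χ₂) :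
    Nonempty (Representation.Equiv
      (show Representation ℂ U _ from (TwistedCoinv.rep χ₁ ω₁ hc₁).comp ι₁)
      (show Representation ℂ U _ from (TwistedCoinv.rep χ₂ ω₂ hc₂).comp ι₂)) := by
  -- the intertwiner between the two `H₁`-presented models
  have hT : ∀ (h : H₁) (v : S), (show Representation ℂ H₁ S from ω₂.comp κ₂') h (T v) =
      (((1 : ℂˣ) : ℂˣ) : ℂ) • T ((show Representation ℂ H₁ S from ω₁.comp κ₁) h v) := fun h v => by
    rw [Units.val_one, one_smul]
    change ω₂ (κ₂' h) (T v) = T (ω₁ (κ₁ h) v)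
    rw [hκ₁, hκ₂', hTι]
  let E₁ := TwistedCoinv.mapEquiv (show Representation ℂ H₁ S from ω₁.comp κ₁) χ₁
    (show Representation ℂ H₁ S from ω₂.comp κ₂') χ₁ T (fun _ => 1) hT (fun h => by rw [one_mul])
  let E₂ : TwistedCoinv.Coinv (show Representation ℂ H₁ S from ω₂.comp κ₂') χ₁ ≃ₗ[ℂ]
      TwistedCoinv.Coinv (show Representation ℂ H₂ S from ω₂.comp κ₂) χ₂ := Submodule.quotEquivOfEq _ _ hker
  refine ⟨Representation.Equiv.mk (E₁.trans E₂) fun u => TwistedCoinv.ext_mk _ χ₁ fun v => ?_⟩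
  change E₂ (E₁ (((TwistedCoinv.rep χ₁ ω₁ hc₁).comp ι₁) u (TwistedCoinv.mk _ χ₁ v))) =
    ((TwistedCoinv.rep χ₂ ω₂ hc₂).comp ι₂) u (E₂ (E₁ (TwistedCoinv.mk _ χ₁ v)))
  rw [MonoidHom.comp_apply, MonoidHom.comp_apply, TwistedCoinv.rep_mk, TwistedCoinv.mapEquiv_mk, TwistedCoinv.mapEquiv_mk, hTι]
  change Submodule.quotEquivOfEq _ _ hker (Submodule.Quotient.mk _) =
    TwistedCoinv.rep χ₂ ω₂ hc₂ (ι₂ u) (Submodule.quotEquivOfEq _ _ hker (Submodule.Quotient.mk _))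
  rw [Submodule.quotEquivOfEq_mk, Submodule.quotEquivOfEq_mk]
  exact (TwistedCoinv.rep_mk χ₂ ω₂ hc₂ (ι₂ u) (T v)).symm

/-! ## §2 The CM instance at `Equiv.prodUnique (Fin 3) (Fin 1)` -/

set_option synthInstance.maxHeartbeats 400000 in
set_option maxHeartbeats 8000000 in
-- heartbeats: the statement spells the two CM local families of record (as ★ `lineTransportOp_omegaLoc_localLineInl'`, 1 600 000 for its statement).
/-- **(LT) at `Equiv.prodUnique (Fin 3) (Fin 1)` — Liu's local theta type depends only on the local class of the line**: stub
`stub_LT_localTypeTransport : StubLTLocalTypeTransport` of `Cruxes/H413/Lines/F0_P2CELocalToGlobal.lean` (mirror 4e2632f0 :240) with the binder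
`{n'} (e₁ : Fin 3 × Fin 1 ≃ Fin n')` instantiated at `Equiv.prodUnique (Fin 3) (Fin 1)`, token for token otherwise.  `T := M_x`; §1 with
★ `lineTransportOp_omegaLoc_localLineInl'`, ★ `localLineInl_localCenter`, ★ `LemD1OfPlace.ker_localCenter_eq_of_line`.
[cite: Liu2021, App. D Lem D.1 (3) (l. 5233)] [cite: MoeglinVignerasWaldspurger1987, Chap. 2 II.1 (A)–(B), Chap. 3 I.1–I.3, IV.4] [cite: Kudla1994, §3 Thm 3.1] -/
theorem stubLT_prodUnique_holds :
  ∀ (L : Type) [Field L] [NumberField L] [IsCMField L] (dV : Fin 3 → L)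
    (hdV : ∀ i, IsCMField.complexConj L (dV i) = dV i) (hdV0 : ∀ i, dV i ≠ 0)
    (μ : Literature.NumberTheory.Automorphic.IdeleClassGroup L →ₜ* Circle) (hμ : IsConjugateSymplectic L μ)
    (a₁ a₂ : (↥(maximalRealSubfield L))ˣ) (χ : Chi (↥(maximalRealSubfield L)) L (IsCMField.complexConj L))
    (v : HeightOneSpectrum (𝓞 ↥(maximalRealSubfield L))) (x : (LocalRing L v)ˣ),
    algebraMap L (LocalRing L v) (algebraMap (↥(maximalRealSubfield L)) L (↑a₂⁻¹ : ↥(maximalRealSubfield L)) * imagUnit L) =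
        (x : LocalRing L v) * conjLocal L (IsCMField.complexConj L) v x *
          algebraMap L (LocalRing L v) (algebraMap (↥(maximalRealSubfield L)) L (↑a₁⁻¹ : ↥(maximalRealSubfield L)) * imagUnit L) →
      Nonempty (Representation.Equiv
        (show Representation ℂ (localPi L (IsCMField.complexConj L) 3 (Matrix.diagonal dV) v) _ from
          (TwistedCoinv.rep (localCharOfCenter (↥(maximalRealSubfield L)) L (IsCMField.complexConj L)
              (JW (↥(maximalRealSubfield L)) L a₁) (JW_apply_ne_zero (↥(maximalRealSubfield L)) L a₁) χ.1 v)
            ((OmegaChiSplitting.chiLocalSplittingsD ⟨L⟩ (Equiv.prodUnique (Fin 3) (Fin 1)) dV hdV hdV0 (toHeckeCharacter L μ)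
              ((isOscillatorChar_toHeckeCharacter_iff μ).mpr hμ) a₁).omegaLoc v)
            (commute_omegaLoc_localCenter (↥(maximalRealSubfield L)) L (IsCMField.complexConj L) 3 (Equiv.prodUnique (Fin 3) (Fin 1)) (Matrix.diagonal dV)
              (JW (↥(maximalRealSubfield L)) L a₁) (complexConj_imagUnit L) (imagUnit_ne_zero L) (imagUnit_mul_self L)
              (realDiagonal_isSymm L dV hdV) (isSymm_TW (↥(maximalRealSubfield L)) a₁) (realDiagonal_map L dV hdV).symm
              (JW_eq (↥(maximalRealSubfield L)) L a₁) (JW_apply_ne_zero (↥(maximalRealSubfield L)) L a₁)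
              (OmegaChiSplitting.chiLocalSplittingsD ⟨L⟩ (Equiv.prodUnique (Fin 3) (Fin 1)) dV hdV hdV0 (toHeckeCharacter L μ)
                ((isOscillatorChar_toHeckeCharacter_iff μ).mpr hμ) a₁) v)).comp
            (UnitaryGroup.localLineInl L (IsCMField.complexConj L) 3 (Equiv.prodUnique (Fin 3) (Fin 1)) (Matrix.diagonal dV) (JW (↥(maximalRealSubfield L)) L a₁) v))
        (show Representation ℂ (localPi L (IsCMField.complexConj L) 3 (Matrix.diagonal dV) v) _ from
          (TwistedCoinv.rep (localCharOfCenter (↥(maximalRealSubfield L)) L (IsCMField.complexConj L)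
              (JW (↥(maximalRealSubfield L)) L a₂) (JW_apply_ne_zero (↥(maximalRealSubfield L)) L a₂) χ.1 v)
            ((OmegaChiSplitting.chiLocalSplittingsD ⟨L⟩ (Equiv.prodUnique (Fin 3) (Fin 1)) dV hdV hdV0 (toHeckeCharacter L μ)
              ((isOscillatorChar_toHeckeCharacter_iff μ).mpr hμ) a₂).omegaLoc v)
            (commute_omegaLoc_localCenter (↥(maximalRealSubfield L)) L (IsCMField.complexConj L) 3 (Equiv.prodUnique (Fin 3) (Fin 1)) (Matrix.diagonal dV)
              (JW (↥(maximalRealSubfield L)) L a₂) (complexConj_imagUnit L) (imagUnit_ne_zero L) (imagUnit_mul_self L)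
              (realDiagonal_isSymm L dV hdV) (isSymm_TW (↥(maximalRealSubfield L)) a₂) (realDiagonal_map L dV hdV).symm
              (JW_eq (↥(maximalRealSubfield L)) L a₂) (JW_apply_ne_zero (↥(maximalRealSubfield L)) L a₂)
              (OmegaChiSplitting.chiLocalSplittingsD ⟨L⟩ (Equiv.prodUnique (Fin 3) (Fin 1)) dV hdV hdV0 (toHeckeCharacter L μ)
                ((isOscillatorChar_toHeckeCharacter_iff μ).mpr hμ) a₂) v)).comp
            (UnitaryGroup.localLineInl L (IsCMField.complexConj L) 3 (Equiv.prodUnique (Fin 3) (Fin 1)) (Matrix.diagonal dV) (JW (↥(maximalRealSubfield L)) L a₂) v))) := by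
  intro L _ _ _ dV hdV hdV0 μ hμ a₁ a₂ χ v x hx
  refine nonempty_equiv_rep_comp_of_intertwiner
    (localCenter L (IsCMField.complexConj L) 3 (Matrix.diagonal dV) (JW (↥(maximalRealSubfield L)) L a₁)
      (JW_apply_ne_zero (↥(maximalRealSubfield L)) L a₁) v)
    (fun h => (localLineInl_localCenter L (IsCMField.complexConj L) 3 (Equiv.prodUnique (Fin 3) (Fin 1)) (Matrix.diagonal dV)
      (JW (↥(maximalRealSubfield L)) L a₁) (JW (↥(maximalRealSubfield L)) L a₁) (JW_apply_ne_zero (↥(maximalRealSubfield L)) L a₁) v h).symm)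
    (fun h => (localLineInl_localCenter L (IsCMField.complexConj L) 3 (Equiv.prodUnique (Fin 3) (Fin 1)) (Matrix.diagonal dV)
      (JW (↥(maximalRealSubfield L)) L a₂) (JW (↥(maximalRealSubfield L)) L a₁) (JW_apply_ne_zero (↥(maximalRealSubfield L)) L a₁) v h).symm)
    (Literature.RepresentationTheory.MoeglinVignerasWaldspurger1987.lineTransportOp L v (IsCMField.complexConj L) 3
      (conj_lineDelta (complexConj_imagUnit L) a₁) (lineDelta_ne_zero (imagUnit_ne_zero L) a₁) (lineDelta_mul_self (imagUnit_mul_self L) a₁)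
      (conj_lineDelta (complexConj_imagUnit L) a₂) (lineDelta_ne_zero (imagUnit_ne_zero L) a₂) (lineDelta_mul_self (imagUnit_mul_self L) a₂) x
      (realDiagonal L dV hdV) (realDiagonal_isSymm L dV hdV) (isUnit_det_realDiagonal L dV hdV hdV0) hx)
    (fun u Φ => lineTransportOp_omegaLoc_localLineInl' L dV hdV hdV0 v (toHeckeCharacter L μ)
      ((isOscillatorChar_toHeckeCharacter_iff μ).mpr hμ) a₁ a₂ x hx u Φ)
    (LemD1OfPlace.ker_localCenter_eq_of_line L v (IsCMField.complexConj L) 3 _ (complexConj_imagUnit L) (imagUnit_ne_zero L) (by norm_num)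
      (reindex_kronecker_JW_hermitian (↥(maximalRealSubfield L)) L (IsCMField.complexConj L) 3 (Equiv.prodUnique (Fin 3) (Fin 1))
        (Matrix.diagonal dV) (realDiagonal_isSymm L dV hdV) (realDiagonal_map L dV hdV).symm a₂)
      (det_reindex_kronecker_JW_ne_zero (↥(maximalRealSubfield L)) L 3 (Equiv.prodUnique (Fin 3) (Fin 1)) (Matrix.diagonal dV)
        (isUnit_det_realDiagonal L dV hdV hdV0) (realDiagonal_map L dV hdV).symm a₂)
      _ χ.1 (JW (↥(maximalRealSubfield L)) L a₁) (JW (↥(maximalRealSubfield L)) L a₂)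
      (JW_apply_ne_zero (↥(maximalRealSubfield L)) L a₁) (JW_apply_ne_zero (↥(maximalRealSubfield L)) L a₂))

/-! ## §3 The general enumeration `e₁`, from a local re-enumeration brick (LR) -/

set_option synthInstance.maxHeartbeats 400000 in
set_option maxHeartbeats 8000000 in
-- heartbeats: as §2 (the statement spells four CM local families of record).
/-- **(LT) at a GENERAL enumeration `e₁ : Fin 3 × Fin 1 ≃ Fin n'`, from a local re-enumeration brick LR** — the registered body of
`stub_LT_localTypeTransport : StubLTLocalTypeTransport` (mirror 4e2632f0 :240) VERBATIM as conclusion, under the hypothesis `hLR`: «for all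
enumerations `e e'` and every line `a`, `X_v(μ,a,χ)[e] ≃ X_v(μ,a,χ)[e']` as `U(diag dV)(L⁺_v)`-representations» (the tree's re-enumeration results ★
`Def411WeilCarriersAtLineReindex` are adelic; LR is their local shadow, a separate brick of the sub-line).  Composition
`X[e₁](a₁) ≃ X[prodUnique](a₁) ≃ X[prodUnique](a₂) ≃ X[e₁](a₂)` (`Representation.Equiv.trans`, §2 in the middle).
[cite: Liu2021, App. D Lem D.1 (3) (l. 5233)] [cite: MoeglinVignerasWaldspurger1987, Chap. 2 II.1 (A)–(B), Chap. 3 I.1–I.3] -/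
theorem stubLT_of_LR
    (hLR : ∀ (L : Type) [Field L] [NumberField L] [IsCMField L] {n n' : ℕ} (e : Fin 3 × Fin 1 ≃ Fin n) (e' : Fin 3 × Fin 1 ≃ Fin n')
      (dV : Fin 3 → L) (hdV : ∀ i, IsCMField.complexConj L (dV i) = dV i) (hdV0 : ∀ i, dV i ≠ 0)
      (μ : Literature.NumberTheory.Automorphic.IdeleClassGroup L →ₜ* Circle) (hμ : IsConjugateSymplectic L μ)
      (a : (↥(maximalRealSubfield L))ˣ) (χ : Chi (↥(maximalRealSubfield L)) L (IsCMField.complexConj L))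
      (v : HeightOneSpectrum (𝓞 ↥(maximalRealSubfield L))),
      Nonempty (Representation.Equiv
        (show Representation ℂ (localPi L (IsCMField.complexConj L) 3 (Matrix.diagonal dV) v) _ from
          (TwistedCoinv.rep (localCharOfCenter (↥(maximalRealSubfield L)) L (IsCMField.complexConj L)
              (JW (↥(maximalRealSubfield L)) L a) (JW_apply_ne_zero (↥(maximalRealSubfield L)) L a) χ.1 v)
            ((OmegaChiSplitting.chiLocalSplittingsD ⟨L⟩ e dV hdV hdV0 (toHeckeCharacter L μ)
              ((isOscillatorChar_toHeckeCharacter_iff μ).mpr hμ) a).omegaLoc v)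
            (commute_omegaLoc_localCenter (↥(maximalRealSubfield L)) L (IsCMField.complexConj L) 3 e (Matrix.diagonal dV)
              (JW (↥(maximalRealSubfield L)) L a) (complexConj_imagUnit L) (imagUnit_ne_zero L) (imagUnit_mul_self L)
              (realDiagonal_isSymm L dV hdV) (isSymm_TW (↥(maximalRealSubfield L)) a) (realDiagonal_map L dV hdV).symm
              (JW_eq (↥(maximalRealSubfield L)) L a) (JW_apply_ne_zero (↥(maximalRealSubfield L)) L a)
              (OmegaChiSplitting.chiLocalSplittingsD ⟨L⟩ e dV hdV hdV0 (toHeckeCharacter L μ)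
                ((isOscillatorChar_toHeckeCharacter_iff μ).mpr hμ) a) v)).comp
            (UnitaryGroup.localLineInl L (IsCMField.complexConj L) 3 e (Matrix.diagonal dV) (JW (↥(maximalRealSubfield L)) L a) v))
        (show Representation ℂ (localPi L (IsCMField.complexConj L) 3 (Matrix.diagonal dV) v) _ from
          (TwistedCoinv.rep (localCharOfCenter (↥(maximalRealSubfield L)) L (IsCMField.complexConj L)
              (JW (↥(maximalRealSubfield L)) L a) (JW_apply_ne_zero (↥(maximalRealSubfield L)) L a) χ.1 v)
            ((OmegaChiSplitting.chiLocalSplittingsD ⟨L⟩ e' dV hdV hdV0 (toHeckeCharacter L μ)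
              ((isOscillatorChar_toHeckeCharacter_iff μ).mpr hμ) a).omegaLoc v)
            (commute_omegaLoc_localCenter (↥(maximalRealSubfield L)) L (IsCMField.complexConj L) 3 e' (Matrix.diagonal dV)
              (JW (↥(maximalRealSubfield L)) L a) (complexConj_imagUnit L) (imagUnit_ne_zero L) (imagUnit_mul_self L)
              (realDiagonal_isSymm L dV hdV) (isSymm_TW (↥(maximalRealSubfield L)) a) (realDiagonal_map L dV hdV).symm
              (JW_eq (↥(maximalRealSubfield L)) L a) (JW_apply_ne_zero (↥(maximalRealSubfield L)) L a)
              (OmegaChiSplitting.chiLocalSplittingsD ⟨L⟩ e' dV hdV hdV0 (toHeckeCharacter L μ)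
                ((isOscillatorChar_toHeckeCharacter_iff μ).mpr hμ) a) v)).comp
            (UnitaryGroup.localLineInl L (IsCMField.complexConj L) 3 e' (Matrix.diagonal dV) (JW (↥(maximalRealSubfield L)) L a) v)))) :
  ∀ (L : Type) [Field L] [NumberField L] [IsCMField L] {n' : ℕ} (e₁ : Fin 3 × Fin 1 ≃ Fin n') (dV : Fin 3 → L)
    (hdV : ∀ i, IsCMField.complexConj L (dV i) = dV i) (hdV0 : ∀ i, dV i ≠ 0)
    (μ : Literature.NumberTheory.Automorphic.IdeleClassGroup L →ₜ* Circle) (hμ : IsConjugateSymplectic L μ)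
    (a₁ a₂ : (↥(maximalRealSubfield L))ˣ) (χ : Chi (↥(maximalRealSubfield L)) L (IsCMField.complexConj L))
    (v : HeightOneSpectrum (𝓞 ↥(maximalRealSubfield L))) (x : (LocalRing L v)ˣ),
    algebraMap L (LocalRing L v) (algebraMap (↥(maximalRealSubfield L)) L (↑a₂⁻¹ : ↥(maximalRealSubfield L)) * imagUnit L) =
        (x : LocalRing L v) * conjLocal L (IsCMField.complexConj L) v x *
          algebraMap L (LocalRing L v) (algebraMap (↥(maximalRealSubfield L)) L (↑a₁⁻¹ : ↥(maximalRealSubfield L)) * imagUnit L) →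
      Nonempty (Representation.Equiv
        (show Representation ℂ (localPi L (IsCMField.complexConj L) 3 (Matrix.diagonal dV) v) _ from
          (TwistedCoinv.rep (localCharOfCenter (↥(maximalRealSubfield L)) L (IsCMField.complexConj L)
              (JW (↥(maximalRealSubfield L)) L a₁) (JW_apply_ne_zero (↥(maximalRealSubfield L)) L a₁) χ.1 v)
            ((OmegaChiSplitting.chiLocalSplittingsD ⟨L⟩ e₁ dV hdV hdV0 (toHeckeCharacter L μ)
              ((isOscillatorChar_toHeckeCharacter_iff μ).mpr hμ) a₁).omegaLoc v)
            (commute_omegaLoc_localCenter (↥(maximalRealSubfield L)) L (IsCMField.complexConj L) 3 e₁ (Matrix.diagonal dV)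
              (JW (↥(maximalRealSubfield L)) L a₁) (complexConj_imagUnit L) (imagUnit_ne_zero L) (imagUnit_mul_self L)
              (realDiagonal_isSymm L dV hdV) (isSymm_TW (↥(maximalRealSubfield L)) a₁) (realDiagonal_map L dV hdV).symm
              (JW_eq (↥(maximalRealSubfield L)) L a₁) (JW_apply_ne_zero (↥(maximalRealSubfield L)) L a₁)
              (OmegaChiSplitting.chiLocalSplittingsD ⟨L⟩ e₁ dV hdV hdV0 (toHeckeCharacter L μ)
                ((isOscillatorChar_toHeckeCharacter_iff μ).mpr hμ) a₁) v)).comp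
            (UnitaryGroup.localLineInl L (IsCMField.complexConj L) 3 e₁ (Matrix.diagonal dV) (JW (↥(maximalRealSubfield L)) L a₁) v))
        (show Representation ℂ (localPi L (IsCMField.complexConj L) 3 (Matrix.diagonal dV) v) _ from
          (TwistedCoinv.rep (localCharOfCenter (↥(maximalRealSubfield L)) L (IsCMField.complexConj L)
              (JW (↥(maximalRealSubfield L)) L a₂) (JW_apply_ne_zero (↥(maximalRealSubfield L)) L a₂) χ.1 v)
            ((OmegaChiSplitting.chiLocalSplittingsD ⟨L⟩ e₁ dV hdV hdV0 (toHeckeCharacter L μ)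
              ((isOscillatorChar_toHeckeCharacter_iff μ).mpr hμ) a₂).omegaLoc v)
            (commute_omegaLoc_localCenter (↥(maximalRealSubfield L)) L (IsCMField.complexConj L) 3 e₁ (Matrix.diagonal dV)
              (JW (↥(maximalRealSubfield L)) L a₂) (complexConj_imagUnit L) (imagUnit_ne_zero L) (imagUnit_mul_self L)
              (realDiagonal_isSymm L dV hdV) (isSymm_TW (↥(maximalRealSubfield L)) a₂) (realDiagonal_map L dV hdV).symm
              (JW_eq (↥(maximalRealSubfield L)) L a₂) (JW_apply_ne_zero (↥(maximalRealSubfield L)) L a₂)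
              (OmegaChiSplitting.chiLocalSplittingsD ⟨L⟩ e₁ dV hdV hdV0 (toHeckeCharacter L μ)
                ((isOscillatorChar_toHeckeCharacter_iff μ).mpr hμ) a₂) v)).comp
            (UnitaryGroup.localLineInl L (IsCMField.complexConj L) 3 e₁ (Matrix.diagonal dV) (JW (↥(maximalRealSubfield L)) L a₂) v))) := by
  intro L _ _ _ n' e₁ dV hdV hdV0 μ hμ a₁ a₂ χ v x hx
  obtain ⟨E₁⟩ := hLR L e₁ (Equiv.prodUnique (Fin 3) (Fin 1)) dV hdV hdV0 μ hμ a₁ χ v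
  obtain ⟨E⟩ := stubLT_prodUnique_holds L dV hdV hdV0 μ hμ a₁ a₂ χ v x hx
  obtain ⟨E₂⟩ := hLR L (Equiv.prodUnique (Fin 3) (Fin 1)) e₁ dV hdV hdV0 μ hμ a₂ χ v
  exact ⟨E₁.trans (E.trans E₂)⟩

end Summit.HodgeConjecture.HodgeConjecture.Cruxes.H413.F0P2eStubLTLocalTypeTransport

end
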